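import Literature.MathematicalPhysics.QuantumFieldTheory.Balaban1983to89.B6BlockDecayHjCovV1
import Literature.MathematicalPhysics.QuantumFieldTheory.Balaban1983to89.B6Cov2110DecayV1
import Literature.MathematicalPhysics.QuantumFieldTheory.BalabanImbrieJaffe1984to88.BIJ85Ineq722Torus

/-!
# `Balaban1983to89.B6BlockDecayHprimeCovV1` — T. Bałaban, *Propagators and renormalization transformations for lattice gauge theories. II*,
# Commun. Math. Phys. **96** (1984) 223–250 [Balaban1984PropagatorsII], Prop. 2.5 p. 246: block decay of the factors `∂H′_j`, `∂ΔH′_j`,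
# their adjoints and `C^{(j)}_Λ` of the operators `K₁`, `K₂` of (2.129), for the concrete two-scale data `tsV1` — file 4 of the two-level
# decay programme (the composites `K₁`, `K₂`, `K₂*` follow in `…B6BlockDecayK12V1`)

statement-level skeleton of published theorems with citation tags; proofs where landed; nothing here is a claim about the Yang–Mills mass gap

p. 246: *"These forms are bounded from below by γ₀‖ξ‖² with a positive constant γ₀ dependent on d and L only. This implies that a covariance
C^{(j)}_Λ of the Gaussian integral in (2.119) is bounded from above by a positive constant dependent on d and L only, and it has an exponential
decay with a decay rate having the same property."* and *"… derivatives of H′_j up to third order, and their local Hölder norms as in (2.67), are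
uniformly bounded and have a uniform exponential decay with a decay rate depending on d only. All the above considerations imply the following
Proposition 2.5. The operator G … has the representation (2.129) and satisfies all the inequalities (1.110)–(1.114) of the Proposition 1.2
with a positive constant δ₂ instead of δ₀. This constant depends on d and L only."*

WHAT THIS FILE DOES.  In the operator form of (2.129) (file 1, `…B6Repr2129Operator.G_eq_op`:
`G = K₁ + (I − K₂)*(G̃_j + H_jC̃^{(j)}_ΛH_j*)(I − K₂)`) the operators `K₁ = T₁CT₁*`, `K₂ = T₃CT₁*`, `K₂* = T₁CT₃*` (`T₁ = ∂H′_j`, `T₃ = ∂ΔH′_j`,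
`C = C^{(j)}_Λ`; file 1's `K1_eq`, `K2_eq`, `adjoint_K2`) are built from two printed decay statements: the kernel decay of the fine derivatives of
`H′_j` up to order three (r03's `…B6Hprime2132Torus.norm_dker_le`, through gen 13's dictionary `…B6HprimeOpNormV1.mul_pdiff_hP` /
`cube_mul_grad_laplace_hP`) and the kernel decay of `C^{(j)}_Λ` (gen 12's `…B6Cov2110DecayV1.cov_kernel_decay_sites`).  This file turns them
into BLOCK ROW-SUM bounds in the sense of file 2 (`…B6BlockDecayCalculus`): §1 the bridge `supDist x y = |rep x − rep y|_T` between the lattice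
calculus' `ℕ`-valued torus sup-distance (Setup; [4]'s cubes and (1.110)) and r03's real one (`supDist_cast_eq_torusSupNorm`), and BLOCK
ADJACENCY `|y(x − e_ν) − y(x)|_T ≤ 1` (`torusDist_blk_unshift_le_one`, p09's `supDist_blk_le_one`); §2 the entries
`T₁(e_y)_{b₀} = (c/n)·Re ∂_{μ₀}H′(EK b₀₋, y)` (`gradHp_single_apply`), `T₃(e_y)_{b₀} = −(c/n)³Σ_ν Re ∂_{μ₀}∂_ν∂_νH′(EK(b₀₋ − e_ν), y)`
(`gradLapHp_single_apply`), their decay (`abs_dker_re_le`, `abs_gradHp_entry_le`, `abs_gradLapHp_entry_le` — the shifted fine points `b₀₋ − e_ν`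
cost a factor `e^{κ}` by block adjacency), the block bounds of `T₁` `(|c|/n·A₁, κ)`, `T₁*` `(|c|/n·A₁·n^{d+1}(d+1), κ)` (column sums over the
fine bonds of a block), `T₃`, `T₃*` (`blockBound_gradHp(_adjoint)`, `blockBound_gradLapHp(_adjoint)`), of `C^{(j)}_Λ` from an entry bound
(`blockBound_C_of_entry`), and gen 12's covariance decay with the order of quantifiers literal and the `c`-dependence isolated:
`|C^{(j)}_Λ(e_{x′})_x| ≤ E/((c/n)⁴n^{d+1})·e^{−δ|x − x′|_T}`, `δ > 0`, `E ≥ 0` depending on `d, L` only (`cov_entry_uniform`).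

DICTIONARY / DIVERGENCES. (1) Carriers, position maps and metric as in file 3 (`iterBlockOf j ∘ src` for fine bonds, the identity for unit
sites, `|rep· − rep·|_T` on `T^{(j)}_1`). (2) The paper's normalisation is `c = η⁻¹ = L^j`; here every `c ≠ 0` with gen 13's explicit
`c/n`-powers (the composites at the scaling are in the next file). (3) `C^{(j)}_Λ`'s decay (gen 12) is uniform in all positive weights.
(4) No new definition, no new hypothesis; every bound is by NAME from r03 (`norm_dker_le`), gen 12 (`cov_kernel_decay_sites`), gen 13
(`mul_pdiff_hP`, `cube_mul_grad_laplace_hP`), p09 (`supDist_blk_le_one`), files 2–3.  NOT summit progress.  Unit `lit-balaban-p22` (gen 14), 2026-08-22.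
-/

noncomputable section

open scoped InnerProductSpace BigOperators
open Finset

namespace Literature.MathematicalPhysics.QuantumFieldTheory.Balaban1983to89.B6BlockDecayHprimeCovV1

open LatticeFieldCalculus B5SectBStatements B5Eq117TorusCarriers B6SectAOperatorsV1 B6SectCOperators
  B6SectCTwoScaleV1 B6SectCTwoScaleV1Lattice B5Eq118OneStroke
open BalabanImbrieJaffe1984to88.BIJ85AxialPropagator411 (BondSpace)
open B4Sect5Torus (IsPseudoDist SumBound)
open B4TorusKernel (periodConst)
open B4TorusKernel.MultiPeriod (circAbs torusSupNorm torusSupNorm_nonneg)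
open B4Sect5Proof (latticeConst latticeConst_nonneg)
open B5Prop11Plancherel (Tor fine)
open B5Blocks16 (blockOf_bpt)
open B5G183Kernel (exists_eq_bpt)
open B5Hk163Strip (kappaN kappaN_pos)
open B5Kernel166Decay (periodConst_pos)
open B6LowerBound2153Torus (toT rep toT_rep)
open B6Hprime2132Holder (MGHD CHolder2132_nonneg)
open B6Hprime2132Torus (dker norm_dker_le)
open B6Hprime2101 (c0_2109 c0_2109_pos)
open B6HprimeOpNormV1 (mul_pdiff_hP cube_mul_grad_laplace_hP iterD_re_eq_sum card_filter_eq_le_one)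
open B6Cov2110DecayV1 (cov_kernel_decay_sites delta0_pos)
open B6BlockDecayCalculus (blockBound_of_entry blockBound_adjoint_of_entry blockBound_comp torusDist_isPseudoDist torusDist_sumBound)
open B6BlockDecayHjCovV1 (blockOf_EK_eq_iterBlockOf card_fiber_src_iterBlockOf_le)
open BalabanImbrieJaffe1984to88.BIJ85Ineq722Torus (supDist_blk_le_one)

/-! ## §1  The bridge `supDist = |rep· − rep·|_T` and block adjacency -/

section Bridge

variable {d : ℕ} (M : Fin (d + 1) → ℕ) [∀ i, NeZero (M i)]

/-- one coordinate: `dist(a − b, Nℤ) = min{(a − b) mod N, (b − a) mod N}` (cast to `ℝ`; cf. `…B1Ineq234Concrete.circAbs_val_sub`).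
[cite: Balaban1984PropagatorsI, p.17 l.30 (torus distance)] -/
private theorem circAbs_val_sub_cast {n : ℕ} [NeZero n] (a b : ZMod n) :
    ((circAbs n (((a.val : ℕ) : ℤ) - ((b.val : ℕ) : ℤ)) : ℤ) : ℝ) = ((min (a - b).val (b - a).val : ℕ) : ℝ) := by
  have hab : (a - b : ZMod n) = (((a.val : ℤ) - (b.val : ℤ) : ℤ) : ZMod n) := by
    push_cast
    rw [ZMod.natCast_zmod_val, ZMod.natCast_zmod_val]
  have hr : (((a - b).val : ℕ) : ℤ) = ((a.val : ℤ) - (b.val : ℤ)) % (n : ℤ) := by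
    rw [hab, ZMod.val_intCast]
  have hs : (b - a).val = if a - b = 0 then 0 else n - (a - b).val := by
    rw [← neg_sub, ZMod.neg_val]
  have key : circAbs n (((a.val : ℕ) : ℤ) - ((b.val : ℕ) : ℤ)) = ((min (a - b).val (b - a).val : ℕ) : ℤ) := by
    unfold circAbs
    rw [← hr, hs]
    split_ifs with h0
    · rw [h0, ZMod.val_zero]; simp
    · have hlt : (a - b).val < n := ZMod.val_lt _
      have : ((n : ℤ) - (((a - b).val : ℕ) : ℤ)) = ((n - (a - b).val : ℕ) : ℤ) := by
        rw [Nat.cast_sub hlt.le]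
      rw [this, ← Nat.cast_min]
  rw [key, Int.cast_natCast]

/-- **THE TWO TORUS SUP-DISTANCES AGREE**: for classes `t, t′` of the unit torus `Π_μ ℤ/M_μ`, r03's `|rep t − rep t′|_T = max_μ dist(t_μ − t′_μ, M_μℤ)`
equals the lattice-calculus sup-distance `max_μ min{(t_μ − t′_μ) mod M_μ, (t′_μ − t_μ) mod M_μ}` ([4] p. 36: *"|y − y′|"* of unit-lattice points of
the torus). [cite: Balaban1984PropagatorsI, p.17 l.30 with p.36 l.20–23] -/
theorem torusSupNorm_rep_sub_rep (t t' : Tor M) :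
    torusSupNorm M (rep M t - rep M t') = ((Finset.univ.sup fun i => min (t i - t' i).val (t' i - t i).val : ℕ) : ℝ) := by
  unfold torusSupNorm
  rw [← Finset.sup'_eq_sup Finset.univ_nonempty, Finset.apply_sup'_eq_sup'_comp Finset.univ_nonempty (fun k : ℕ => (k : ℝ)) (fun a b => Nat.cast_max a b)]
  refine Finset.sup'_congr Finset.univ_nonempty rfl fun i _ => ?_
  rw [Function.comp_apply, ← circAbs_val_sub_cast]
  rfl

variable {L m K : ℕ} {hd : 1 ≤ d + 1} {hL : Odd L ∧ 1 < L} {j : ℕ}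

/-- **`supDist x y = |rep x − rep y|_T`** on the unit torus `T^{(j)}_1` of the model: the `ℕ`-valued sup-distance of the lattice calculus (Setup; [4]'s
cubes and (1.110)) IS r03's real torus sup-distance (the decay statements of b05, r03, gen 12). [cite: Balaban1984PropagatorsI, p.36 l.20–23] -/
theorem supDist_cast_eq_torusSupNorm (x y : Site (⟨d + 1, L, m, K, hd, hL⟩ : Params) j) :
    (supDist x y : ℝ) = torusSupNorm (Mk (⟨d + 1, L, m, K, hd, hL⟩ : Params) j)
      (rep (Mk (⟨d + 1, L, m, K, hd, hL⟩ : Params) j) x - rep (Mk (⟨d + 1, L, m, K, hd, hL⟩ : Params) j) y) := by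
  rw [torusSupNorm_rep_sub_rep]
  rfl

/-- a fine site and its backward neighbour are at sup-distance `≤ 1`. [cite: Balaban1984PropagatorsI, (1.4) p.18] -/
private theorem supDist_unshift_le_one {P : Params} (x : Site P 0) (ν : Fin P.d) : supDist (x.unshift ν) x ≤ 1 := by
  unfold supDist
  refine Finset.sup_le fun μ _ => ?_
  simp only [Site.unshift]
  by_cases h : μ = ν
  · subst h
    rw [Function.update_self, sub_sub_cancel_left, sub_sub_cancel]
    refine (min_le_right _ _).trans ?_
    rw [ZMod.val_one_eq_one_mod]
    exact Nat.mod_le 1 _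
  · rw [Function.update_of_ne h, sub_self, ZMod.val_zero]
    exact (min_le_left _ _).trans (Nat.zero_le _)

/-- **BLOCK ADJACENCY**: the `j`-blocks of a fine site `x` and of `x − e_ν` coincide or are adjacent, `|y(x − e_ν) − y(x)|_T ≤ 1` (p09's
`supDist_blk_le_one`, [BalabanImbrieJaffe1985] (5.1.2)–(5.1.3), through the bridge). [cite: Balaban1984PropagatorsI, (1.18) p.20] -/
theorem torusDist_blk_unshift_le_one (hj : j ≤ (⟨d + 1, L, m, K, hd, hL⟩ : Params).m + (⟨d + 1, L, m, K, hd, hL⟩ : Params).K)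
    (x : Site (⟨d + 1, L, m, K, hd, hL⟩ : Params) 0) (ν : Fin (d + 1)) :
    torusSupNorm (Mk (⟨d + 1, L, m, K, hd, hL⟩ : Params) j)
      (rep (Mk (⟨d + 1, L, m, K, hd, hL⟩ : Params) j) (iterBlockOf j (x.unshift ν)) - rep (Mk (⟨d + 1, L, m, K, hd, hL⟩ : Params) j) (iterBlockOf j x)) ≤ 1 := by
  rw [← supDist_cast_eq_torusSupNorm]
  have h := supDist_blk_le_one hj (x.unshift ν) x ((supDist_unshift_le_one x ν).trans (Nat.one_le_pow _ _ (Params.L_pos _)))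
  exact_mod_cast h

/-- the torus sup-distance vanishes only on equal sites (`…B3TorusRadialSums.supDist_eq_zero_iff` through the bridge).
[cite: Balaban1984PropagatorsI, p.36 l.20–23] -/
theorem eq_of_torusDist_le_zero {x y : Site (⟨d + 1, L, m, K, hd, hL⟩ : Params) j}
    (h : torusSupNorm (Mk (⟨d + 1, L, m, K, hd, hL⟩ : Params) j)
      (rep (Mk (⟨d + 1, L, m, K, hd, hL⟩ : Params) j) x - rep (Mk (⟨d + 1, L, m, K, hd, hL⟩ : Params) j) y) ≤ 0) : x = y := by
  rw [← supDist_cast_eq_torusSupNorm] at h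
  have h0 : supDist x y = 0 := by exact_mod_cast le_antisymm h (Nat.cast_nonneg _)
  exact (B3TorusRadialSums.supDist_eq_zero_iff x y).1 h0

end Bridge

/-! ## §2  Entries and block bounds of `T₁ = ∂H′_j`, `T₃ = ∂ΔH′_j`, their adjoints, and `C^{(j)}_Λ` -/

section Entries

variable {P : Params} {c : ℝ} (hc : c ≠ 0) {j : ℕ} (hj : j ≤ P.m + P.K) (Λ' : Finset (Site P (j + 1))) (w : CIdx j Λ' → ℝ)

/-- **`T₁(e_y)_{b₀} = (c/n)·Re ∂_{μ₀}H′(EK b₀₋, y)`**: the entry of `∂H′_j` between the unit site `y` and the fine bond `b₀ = ⟨x, μ₀⟩` is `c/n` times r03's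
first-derivative kernel (gen 13's `mul_pdiff_hP` on the basis vector `e_y`). [cite: Balaban1984PropagatorsII, p.246 («derivatives of H′_j up to third order»)] -/
theorem gradHp_single_apply (y : Site P j) (b₀ : PBond P 0) :
    ((tsV1 hc Λ' w).grad ∘ₗ (tsV1 hc Λ' w).hP) (EuclideanSpace.single y (1 : ℝ)) b₀ =
      c / (P.L : ℝ) ^ j * (dker (P.L ^ j) (Mk P j) ![b₀.dir] (EK hj b₀.src) y).re := by
  have hn : ((P.L : ℝ) ^ j) ≠ 0 := pow_ne_zero _ (Nat.cast_ne_zero.2 (Params.L_pos P).ne')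
  have h := mul_pdiff_hP hc hj (EuclideanSpace.single y (1 : ℝ)) b₀.src b₀.dir
  rw [iterD_re_eq_sum] at h
  simp only [PiLp.single_apply, mul_ite, mul_one, mul_zero, Finset.sum_ite_eq', Finset.mem_univ, if_true] at h
  rw [LinearMap.comp_apply]
  show dE c (B6SectCTwoScaleV1Lattice.hP hc j (EuclideanSpace.single y (1 : ℝ))) b₀ = _
  rw [dE_apply]
  simp only [grad, PBond.tgt, smul_eq_mul]
  rw [show WithLp.ofLp (B6SectCTwoScaleV1Lattice.hP hc j (EuclideanSpace.single y (1 : ℝ))) (b₀.src.shift b₀.dir) =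
      B6SectCTwoScaleV1Lattice.hP hc j (EuclideanSpace.single y (1 : ℝ)) (b₀.src.shift b₀.dir) from rfl,
    show WithLp.ofLp (B6SectCTwoScaleV1Lattice.hP hc j (EuclideanSpace.single y (1 : ℝ))) b₀.src =
      B6SectCTwoScaleV1Lattice.hP hc j (EuclideanSpace.single y (1 : ℝ)) b₀.src from rfl, ← h]
  field_simp

/-- **`T₃(e_y)_{b₀} = −(c/n)³·Σ_ν Re ∂_{μ₀}∂_ν∂_νH′(EK(b₀₋ − e_ν), y)`**: the entry of `∂ΔH′_j` (gen 13's `cube_mul_grad_laplace_hP` on `e_y`).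
[cite: Balaban1984PropagatorsII, p.246 («derivatives of H′_j up to third order»)] -/
theorem gradLapHp_single_apply (y : Site P j) (b₀ : PBond P 0) :
    ((tsV1 hc Λ' w).grad ∘ₗ (tsV1 hc Λ' w).lap ∘ₗ (tsV1 hc Λ' w).hP) (EuclideanSpace.single y (1 : ℝ)) b₀ =
      -((c / (P.L : ℝ) ^ j) ^ 3) * ∑ ν : Fin P.d, (dker (P.L ^ j) (Mk P j) ![b₀.dir, ν, ν] (EK hj (b₀.src.unshift ν)) y).re := by
  have hn : ((P.L : ℝ) ^ j) ≠ 0 := pow_ne_zero _ (Nat.cast_ne_zero.2 (Params.L_pos P).ne')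
  have h := cube_mul_grad_laplace_hP hc hj (EuclideanSpace.single y (1 : ℝ)) b₀.src b₀.dir
  simp only [iterD_re_eq_sum, PiLp.single_apply, mul_ite, mul_one, mul_zero, Finset.sum_ite_eq', Finset.mem_univ, if_true] at h
  rw [LinearMap.comp_apply, LinearMap.comp_apply]
  show dE c (lapE c (B6SectCTwoScaleV1Lattice.hP hc j (EuclideanSpace.single y (1 : ℝ)))) b₀ = _
  rw [dE_apply, ofLp_lapE]
  have e : grad c (laplace c (WithLp.ofLp (B6SectCTwoScaleV1Lattice.hP hc j (EuclideanSpace.single y (1 : ℝ))))) b₀ =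
      (((P.L : ℝ) ^ j) ^ 3)⁻¹ * (-(c ^ 3) * ∑ ν : Fin P.d, (dker (P.L ^ j) (Mk P j) ![b₀.dir, ν, ν] (EK hj (b₀.src.unshift ν)) y).re) := by
    rw [← h, ← mul_assoc, inv_mul_cancel₀ (pow_ne_zero 3 hn), one_mul]
  rw [e]
  field_simp

end Entries

section Factors

/-! r03's torus sup-metric is written with the dimension as `d + 1`; every `P : Params` is of the form `⟨d + 1, L, m, K, _, _⟩`. -/

variable {d L m K : ℕ} [NeZero L] {hd : 1 ≤ d + 1} {hL : Odd L ∧ 1 < L} {c : ℝ} (hc : c ≠ 0) {j : ℕ}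
  (hj : j ≤ (⟨d + 1, L, m, K, hd, hL⟩ : Params).m + (⟨d + 1, L, m, K, hd, hL⟩ : Params).K)
  (Λ' : Finset (Site (⟨d + 1, L, m, K, hd, hL⟩ : Params) (j + 1))) (w : CIdx j Λ' → ℝ)

/-- `0 ≤ MGHD(d, m)` (r03's strip constant of the derivative kernels of `H′_j`). [cite: Balaban1984PropagatorsII, (2.132) p.246] -/
theorem MGHD_nonneg (d' m' : ℕ) : 0 ≤ MGHD d' m' := by
  unfold MGHD
  exact mul_nonneg (pow_nonneg (Real.exp_pos 1).le _) (CHolder2132_nonneg _ _ _)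

include hj in
/-- **THE DERIVATIVE KERNELS OF `H′_j` DECAY** (r03's `norm_dker_le` BY NAME, read at a fine point through its block): for `m ≤ 3` directions,
`|Re ∂^m_{νs}H′(EK x, y)| ≤ A_m·e^{−κ|y(x) − y|_T}`, `A_m = MGHD(d+1,m)·periodConst(κ_N(d+1),d)`, `κ = κ_N(d+1)/(d+1)`.
[cite: Balaban1984PropagatorsII, p.246 («derivatives of H′_j up to third order … uniform exponential decay»)] -/
theorem abs_dker_re_le {mo : ℕ} (hmo : mo ≤ 3) (νs : Fin mo → Fin (d + 1)) (x : Site (⟨d + 1, L, m, K, hd, hL⟩ : Params) 0)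
    (y : Site (⟨d + 1, L, m, K, hd, hL⟩ : Params) j) :
    |(dker ((⟨d + 1, L, m, K, hd, hL⟩ : Params).L ^ j) (Mk (⟨d + 1, L, m, K, hd, hL⟩ : Params) j) νs (EK hj x) y).re| ≤
      (MGHD (d + 1) mo * periodConst (kappaN (d + 1)) d) * Real.exp (-(kappaN (d + 1) / ((d : ℝ) + 1) *
        torusSupNorm (Mk (⟨d + 1, L, m, K, hd, hL⟩ : Params) j)
          (rep (Mk (⟨d + 1, L, m, K, hd, hL⟩ : Params) j) (iterBlockOf j x) - rep (Mk (⟨d + 1, L, m, K, hd, hL⟩ : Params) j) y))) := by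
  obtain ⟨y', r, h⟩ := exists_eq_bpt ((⟨d + 1, L, m, K, hd, hL⟩ : Params).L ^ j) (Mk (⟨d + 1, L, m, K, hd, hL⟩ : Params) j) (EK hj x)
  have hb : iterBlockOf j x = y' := by
    rw [← blockOf_EK_eq_iterBlockOf hj, h, blockOf_bpt]
  rw [hb, h]
  have h2 := norm_dker_le ((⟨d + 1, L, m, K, hd, hL⟩ : Params).L ^ j) (Mk (⟨d + 1, L, m, K, hd, hL⟩ : Params) j) r νs hmo
    (rep (Mk (⟨d + 1, L, m, K, hd, hL⟩ : Params) j) y') (rep (Mk (⟨d + 1, L, m, K, hd, hL⟩ : Params) j) y)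
  rw [toT_rep, toT_rep] at h2
  exact (Complex.abs_re_le_norm _).trans h2

include hj in
/-- **THE ENTRIES OF `T₁ = ∂H′_j` DECAY**: `|T₁(e_y)_{b₀}| ≤ (|c|/n)·A₁·e^{−κ|y(b₀₋) − y|_T}`. [cite: Balaban1984PropagatorsII, p.246 (text after (2.132))] -/
theorem abs_gradHp_entry_le (y : Site (⟨d + 1, L, m, K, hd, hL⟩ : Params) j) (b₀ : PBond (⟨d + 1, L, m, K, hd, hL⟩ : Params) 0) :
    |((tsV1 hc Λ' w).grad ∘ₗ (tsV1 hc Λ' w).hP) (EuclideanSpace.single y (1 : ℝ)) b₀| ≤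
      |c| / (L : ℝ) ^ j * (MGHD (d + 1) 1 * periodConst (kappaN (d + 1)) d) * Real.exp (-(kappaN (d + 1) / ((d : ℝ) + 1) *
        torusSupNorm (Mk (⟨d + 1, L, m, K, hd, hL⟩ : Params) j)
          (rep (Mk (⟨d + 1, L, m, K, hd, hL⟩ : Params) j) (iterBlockOf j b₀.src) - rep (Mk (⟨d + 1, L, m, K, hd, hL⟩ : Params) j) y))) := by
  have hLj : (0 : ℝ) < (L : ℝ) ^ j := pow_pos (Nat.cast_pos.2 (Nat.pos_of_ne_zero (NeZero.ne L))) _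
  rw [gradHp_single_apply hc hj, abs_mul, abs_div, abs_of_pos hLj, mul_assoc]
  exact mul_le_mul_of_nonneg_left (abs_dker_re_le hj (by norm_num) ![b₀.dir] b₀.src y) (by positivity)

include hj in
/-- **THE ENTRIES OF `T₃ = ∂ΔH′_j` DECAY**: `|T₃(e_y)_{b₀}| ≤ (|c|/n)³(d+1)A₃e^{κ}·e^{−κ|y(b₀₋) − y|_T}` — each shifted fine point `b₀₋ − e_ν` lies in the
block of `b₀₋` or an adjacent one (`torusDist_blk_unshift_le_one`), which costs the factor `e^{κ}`. [cite: Balaban1984PropagatorsII, p.246 (text after (2.132))] -/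
theorem abs_gradLapHp_entry_le (y : Site (⟨d + 1, L, m, K, hd, hL⟩ : Params) j) (b₀ : PBond (⟨d + 1, L, m, K, hd, hL⟩ : Params) 0) :
    |((tsV1 hc Λ' w).grad ∘ₗ (tsV1 hc Λ' w).lap ∘ₗ (tsV1 hc Λ' w).hP) (EuclideanSpace.single y (1 : ℝ)) b₀| ≤
      (|c| / (L : ℝ) ^ j) ^ 3 * (((d + 1 : ℕ) : ℝ) * (MGHD (d + 1) 3 * periodConst (kappaN (d + 1)) d) * Real.exp (kappaN (d + 1) / ((d : ℝ) + 1))) *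
        Real.exp (-(kappaN (d + 1) / ((d : ℝ) + 1) *
          torusSupNorm (Mk (⟨d + 1, L, m, K, hd, hL⟩ : Params) j)
            (rep (Mk (⟨d + 1, L, m, K, hd, hL⟩ : Params) j) (iterBlockOf j b₀.src) - rep (Mk (⟨d + 1, L, m, K, hd, hL⟩ : Params) j) y))) := by
  have hLj : (0 : ℝ) < (L : ℝ) ^ j := pow_pos (Nat.cast_pos.2 (Nat.pos_of_ne_zero (NeZero.ne L))) _
  have hκ0 : 0 < kappaN (d + 1) / ((d : ℝ) + 1) := div_pos (kappaN_pos _) (by positivity)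
  have hA : 0 ≤ MGHD (d + 1) 3 * periodConst (kappaN (d + 1)) d := mul_nonneg (MGHD_nonneg _ _) (periodConst_pos (kappaN_pos _) _).le
  have hρ := torusDist_isPseudoDist (Mk (⟨d + 1, L, m, K, hd, hL⟩ : Params) j)
  rw [gradLapHp_single_apply hc hj, abs_mul, abs_neg, abs_pow, abs_div, abs_of_pos hLj]
  -- each summand: adjacency of the blocks of `b₀₋ − e_ν` and `b₀₋`
  have key : ∀ ν : Fin (d + 1),
      |(dker ((⟨d + 1, L, m, K, hd, hL⟩ : Params).L ^ j) (Mk (⟨d + 1, L, m, K, hd, hL⟩ : Params) j) ![b₀.dir, ν, ν] (EK hj (b₀.src.unshift ν)) y).re| ≤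
        (MGHD (d + 1) 3 * periodConst (kappaN (d + 1)) d) * (Real.exp (kappaN (d + 1) / ((d : ℝ) + 1)) *
          Real.exp (-(kappaN (d + 1) / ((d : ℝ) + 1) *
            torusSupNorm (Mk (⟨d + 1, L, m, K, hd, hL⟩ : Params) j)
              (rep (Mk (⟨d + 1, L, m, K, hd, hL⟩ : Params) j) (iterBlockOf j b₀.src) - rep (Mk (⟨d + 1, L, m, K, hd, hL⟩ : Params) j) y)))) := by
    intro ν
    refine (abs_dker_re_le hj le_rfl ![b₀.dir, ν, ν] (b₀.src.unshift ν) y).trans (mul_le_mul_of_nonneg_left ?_ hA)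
    rw [← Real.exp_add]
    refine Real.exp_le_exp.2 ?_
    have h1 := hρ.triangle (iterBlockOf j b₀.src) (iterBlockOf j (b₀.src.unshift ν)) y
    have h2 := torusDist_blk_unshift_le_one (hd := hd) (hL := hL) hj b₀.src ν
    rw [hρ.symm] at h2
    have h3 := mul_le_mul_of_nonneg_left (show torusSupNorm (Mk (⟨d + 1, L, m, K, hd, hL⟩ : Params) j)
        (rep (Mk (⟨d + 1, L, m, K, hd, hL⟩ : Params) j) (iterBlockOf j b₀.src) - rep (Mk (⟨d + 1, L, m, K, hd, hL⟩ : Params) j) y) ≤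
      1 + torusSupNorm (Mk (⟨d + 1, L, m, K, hd, hL⟩ : Params) j)
        (rep (Mk (⟨d + 1, L, m, K, hd, hL⟩ : Params) j) (iterBlockOf j (b₀.src.unshift ν)) - rep (Mk (⟨d + 1, L, m, K, hd, hL⟩ : Params) j) y)
      by linarith) hκ0.le
    linarith
  calc (|c| / (L : ℝ) ^ j) ^ 3 * |∑ ν : Fin (d + 1),
          (dker ((⟨d + 1, L, m, K, hd, hL⟩ : Params).L ^ j) (Mk (⟨d + 1, L, m, K, hd, hL⟩ : Params) j) ![b₀.dir, ν, ν] (EK hj (b₀.src.unshift ν)) y).re|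
      ≤ (|c| / (L : ℝ) ^ j) ^ 3 * ∑ ν : Fin (d + 1),
          |(dker ((⟨d + 1, L, m, K, hd, hL⟩ : Params).L ^ j) (Mk (⟨d + 1, L, m, K, hd, hL⟩ : Params) j) ![b₀.dir, ν, ν] (EK hj (b₀.src.unshift ν)) y).re| := by
        gcongr
        exact Finset.abs_sum_le_sum_abs _ _
    _ ≤ (|c| / (L : ℝ) ^ j) ^ 3 * ∑ _ν : Fin (d + 1),
          (MGHD (d + 1) 3 * periodConst (kappaN (d + 1)) d) * (Real.exp (kappaN (d + 1) / ((d : ℝ) + 1)) *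
            Real.exp (-(kappaN (d + 1) / ((d : ℝ) + 1) *
              torusSupNorm (Mk (⟨d + 1, L, m, K, hd, hL⟩ : Params) j)
                (rep (Mk (⟨d + 1, L, m, K, hd, hL⟩ : Params) j) (iterBlockOf j b₀.src) - rep (Mk (⟨d + 1, L, m, K, hd, hL⟩ : Params) j) y)))) := by
        gcongr with ν
        exact key ν
    _ = _ := by rw [Finset.sum_const, Finset.card_univ, Fintype.card_fin, nsmul_eq_mul]; push_cast; ring

variable [DecidableEq (PBond (⟨d + 1, L, m, K, hd, hL⟩ : Params) 0)]

omit [DecidableEq (PBond (⟨d + 1, L, m, K, hd, hL⟩ : Params) 0)] in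
include hj in
/-- **block bound for `T₁ = ∂H′_j`** (unit sites → fine bonds; one unit site per fibre): `(|c|/n·A₁, κ)`. [cite: Balaban1984PropagatorsII, p.246 (text after (2.132))] -/
theorem blockBound_gradHp (b₀ : PBond (⟨d + 1, L, m, K, hd, hL⟩ : Params) 0) (y : Site (⟨d + 1, L, m, K, hd, hL⟩ : Params) j) :
    ∑ y' ∈ univ.filter (fun y' : Site (⟨d + 1, L, m, K, hd, hL⟩ : Params) j => y' = y),
        |((tsV1 hc Λ' w).grad ∘ₗ (tsV1 hc Λ' w).hP) (EuclideanSpace.single y' (1 : ℝ)) b₀| ≤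
      |c| / (L : ℝ) ^ j * (MGHD (d + 1) 1 * periodConst (kappaN (d + 1)) d) * ((1 : ℕ) : ℝ) * Real.exp (-(kappaN (d + 1) / ((d : ℝ) + 1) *
        torusSupNorm (Mk (⟨d + 1, L, m, K, hd, hL⟩ : Params) j)
          (rep (Mk (⟨d + 1, L, m, K, hd, hL⟩ : Params) j) (iterBlockOf j b₀.src) - rep (Mk (⟨d + 1, L, m, K, hd, hL⟩ : Params) j) y))) := by
  have hLj : (0 : ℝ) < (L : ℝ) ^ j := pow_pos (Nat.cast_pos.2 (Nat.pos_of_ne_zero (NeZero.ne L))) _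
  exact blockBound_of_entry (ρ := (fun t t' : Site (⟨d + 1, L, m, K, hd, hL⟩ : Params) j => torusSupNorm (Mk (⟨d + 1, L, m, K, hd, hL⟩ : Params) j) (rep (Mk (⟨d + 1, L, m, K, hd, hL⟩ : Params) j) t - rep (Mk (⟨d + 1, L, m, K, hd, hL⟩ : Params) j) t')))
    ((tsV1 hc Λ' w).grad ∘ₗ (tsV1 hc Λ' w).hP) (fun b₀ : PBond (⟨d + 1, L, m, K, hd, hL⟩ : Params) 0 => iterBlockOf j b₀.src)
    (fun y : Site (⟨d + 1, L, m, K, hd, hL⟩ : Params) j => y)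
    (mul_nonneg (div_nonneg (abs_nonneg c) hLj.le) (mul_nonneg (MGHD_nonneg _ _) (periodConst_pos (kappaN_pos _) _).le))
    (card_filter_eq_le_one (P := (⟨d + 1, L, m, K, hd, hL⟩ : Params)) (j := j)) (fun b₀ y => abs_gradHp_entry_le hc hj Λ' w y b₀) b₀ y

include hj in
/-- **block bound for `T₁* = (∂H′_j)*`** (fine bonds → unit sites; the column sums of `T₁` over the `n^{d+1}(d+1)` fine bonds of a block):
`(|c|/n·A₁·n^{d+1}(d+1), κ)`. [cite: Balaban1984PropagatorsII, p.246 (text after (2.132))] -/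
theorem blockBound_gradHp_adjoint (y' y : Site (⟨d + 1, L, m, K, hd, hL⟩ : Params) j) :
    ∑ b₀ ∈ univ.filter (fun b₀ : PBond (⟨d + 1, L, m, K, hd, hL⟩ : Params) 0 => iterBlockOf j b₀.src = y),
        |LinearMap.adjoint ((tsV1 hc Λ' w).grad ∘ₗ (tsV1 hc Λ' w).hP) (EuclideanSpace.single b₀ (1 : ℝ)) y'| ≤
      |c| / (L : ℝ) ^ j * (MGHD (d + 1) 1 * periodConst (kappaN (d + 1)) d) * (((L ^ j) ^ (d + 1) * (d + 1) : ℕ) : ℝ) *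
        Real.exp (-(kappaN (d + 1) / ((d : ℝ) + 1) *
          torusSupNorm (Mk (⟨d + 1, L, m, K, hd, hL⟩ : Params) j)
            (rep (Mk (⟨d + 1, L, m, K, hd, hL⟩ : Params) j) y' - rep (Mk (⟨d + 1, L, m, K, hd, hL⟩ : Params) j) y))) := by
  have hLj : (0 : ℝ) < (L : ℝ) ^ j := pow_pos (Nat.cast_pos.2 (Nat.pos_of_ne_zero (NeZero.ne L))) _
  exact blockBound_adjoint_of_entry (ρ := (fun t t' : Site (⟨d + 1, L, m, K, hd, hL⟩ : Params) j => torusSupNorm (Mk (⟨d + 1, L, m, K, hd, hL⟩ : Params) j) (rep (Mk (⟨d + 1, L, m, K, hd, hL⟩ : Params) j) t - rep (Mk (⟨d + 1, L, m, K, hd, hL⟩ : Params) j) t')))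
    (torusDist_isPseudoDist (Mk (⟨d + 1, L, m, K, hd, hL⟩ : Params) j)) ((tsV1 hc Λ' w).grad ∘ₗ (tsV1 hc Λ' w).hP)
    (fun b₀ : PBond (⟨d + 1, L, m, K, hd, hL⟩ : Params) 0 => iterBlockOf j b₀.src) (fun y : Site (⟨d + 1, L, m, K, hd, hL⟩ : Params) j => y)
    (mul_nonneg (div_nonneg (abs_nonneg c) hLj.le) (mul_nonneg (MGHD_nonneg _ _) (periodConst_pos (kappaN_pos _) _).le))
    (card_fiber_src_iterBlockOf_le (P := (⟨d + 1, L, m, K, hd, hL⟩ : Params)) hj) (fun b₀ y => abs_gradHp_entry_le hc hj Λ' w y b₀) y' y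

omit [DecidableEq (PBond (⟨d + 1, L, m, K, hd, hL⟩ : Params) 0)] in
include hj in
/-- **block bound for `T₃ = ∂ΔH′_j`**: `((|c|/n)³(d+1)A₃e^{κ}, κ)`. [cite: Balaban1984PropagatorsII, p.246 (text after (2.132))] -/
theorem blockBound_gradLapHp (b₀ : PBond (⟨d + 1, L, m, K, hd, hL⟩ : Params) 0) (y : Site (⟨d + 1, L, m, K, hd, hL⟩ : Params) j) :
    ∑ y' ∈ univ.filter (fun y' : Site (⟨d + 1, L, m, K, hd, hL⟩ : Params) j => y' = y),
        |((tsV1 hc Λ' w).grad ∘ₗ (tsV1 hc Λ' w).lap ∘ₗ (tsV1 hc Λ' w).hP) (EuclideanSpace.single y' (1 : ℝ)) b₀| ≤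
      (|c| / (L : ℝ) ^ j) ^ 3 * (((d + 1 : ℕ) : ℝ) * (MGHD (d + 1) 3 * periodConst (kappaN (d + 1)) d) * Real.exp (kappaN (d + 1) / ((d : ℝ) + 1))) *
        ((1 : ℕ) : ℝ) * Real.exp (-(kappaN (d + 1) / ((d : ℝ) + 1) *
          torusSupNorm (Mk (⟨d + 1, L, m, K, hd, hL⟩ : Params) j)
            (rep (Mk (⟨d + 1, L, m, K, hd, hL⟩ : Params) j) (iterBlockOf j b₀.src) - rep (Mk (⟨d + 1, L, m, K, hd, hL⟩ : Params) j) y))) := by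
  have hLj : (0 : ℝ) < (L : ℝ) ^ j := pow_pos (Nat.cast_pos.2 (Nat.pos_of_ne_zero (NeZero.ne L))) _
  have hA : 0 ≤ MGHD (d + 1) 3 * periodConst (kappaN (d + 1)) d := mul_nonneg (MGHD_nonneg _ _) (periodConst_pos (kappaN_pos _) _).le
  exact blockBound_of_entry (ρ := (fun t t' : Site (⟨d + 1, L, m, K, hd, hL⟩ : Params) j => torusSupNorm (Mk (⟨d + 1, L, m, K, hd, hL⟩ : Params) j) (rep (Mk (⟨d + 1, L, m, K, hd, hL⟩ : Params) j) t - rep (Mk (⟨d + 1, L, m, K, hd, hL⟩ : Params) j) t')))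
    ((tsV1 hc Λ' w).grad ∘ₗ (tsV1 hc Λ' w).lap ∘ₗ (tsV1 hc Λ' w).hP) (fun b₀ : PBond (⟨d + 1, L, m, K, hd, hL⟩ : Params) 0 => iterBlockOf j b₀.src)
    (fun y : Site (⟨d + 1, L, m, K, hd, hL⟩ : Params) j => y) (by positivity)
    (card_filter_eq_le_one (P := (⟨d + 1, L, m, K, hd, hL⟩ : Params)) (j := j)) (fun b₀ y => abs_gradLapHp_entry_le hc hj Λ' w y b₀) b₀ y

include hj in
/-- **block bound for `T₃* = (∂ΔH′_j)*`**: `((|c|/n)³(d+1)A₃e^{κ}·n^{d+1}(d+1), κ)`. [cite: Balaban1984PropagatorsII, p.246 (text after (2.132))] -/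
theorem blockBound_gradLapHp_adjoint (y' y : Site (⟨d + 1, L, m, K, hd, hL⟩ : Params) j) :
    ∑ b₀ ∈ univ.filter (fun b₀ : PBond (⟨d + 1, L, m, K, hd, hL⟩ : Params) 0 => iterBlockOf j b₀.src = y),
        |LinearMap.adjoint ((tsV1 hc Λ' w).grad ∘ₗ (tsV1 hc Λ' w).lap ∘ₗ (tsV1 hc Λ' w).hP) (EuclideanSpace.single b₀ (1 : ℝ)) y'| ≤
      (|c| / (L : ℝ) ^ j) ^ 3 * (((d + 1 : ℕ) : ℝ) * (MGHD (d + 1) 3 * periodConst (kappaN (d + 1)) d) * Real.exp (kappaN (d + 1) / ((d : ℝ) + 1))) *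
        (((L ^ j) ^ (d + 1) * (d + 1) : ℕ) : ℝ) * Real.exp (-(kappaN (d + 1) / ((d : ℝ) + 1) *
          torusSupNorm (Mk (⟨d + 1, L, m, K, hd, hL⟩ : Params) j)
            (rep (Mk (⟨d + 1, L, m, K, hd, hL⟩ : Params) j) y' - rep (Mk (⟨d + 1, L, m, K, hd, hL⟩ : Params) j) y))) := by
  have hLj : (0 : ℝ) < (L : ℝ) ^ j := pow_pos (Nat.cast_pos.2 (Nat.pos_of_ne_zero (NeZero.ne L))) _
  have hA : 0 ≤ MGHD (d + 1) 3 * periodConst (kappaN (d + 1)) d := mul_nonneg (MGHD_nonneg _ _) (periodConst_pos (kappaN_pos _) _).le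
  exact blockBound_adjoint_of_entry (ρ := (fun t t' : Site (⟨d + 1, L, m, K, hd, hL⟩ : Params) j => torusSupNorm (Mk (⟨d + 1, L, m, K, hd, hL⟩ : Params) j) (rep (Mk (⟨d + 1, L, m, K, hd, hL⟩ : Params) j) t - rep (Mk (⟨d + 1, L, m, K, hd, hL⟩ : Params) j) t')))
    (torusDist_isPseudoDist (Mk (⟨d + 1, L, m, K, hd, hL⟩ : Params) j)) ((tsV1 hc Λ' w).grad ∘ₗ (tsV1 hc Λ' w).lap ∘ₗ (tsV1 hc Λ' w).hP)
    (fun b₀ : PBond (⟨d + 1, L, m, K, hd, hL⟩ : Params) 0 => iterBlockOf j b₀.src) (fun y : Site (⟨d + 1, L, m, K, hd, hL⟩ : Params) j => y)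
    (by positivity) (card_fiber_src_iterBlockOf_le (P := (⟨d + 1, L, m, K, hd, hL⟩ : Params)) hj)
    (fun b₀ y => abs_gradLapHp_entry_le hc hj Λ' w y b₀) y' y

omit [NeZero L] [DecidableEq (PBond (⟨d + 1, L, m, K, hd, hL⟩ : Params) 0)] in
/-- **block bound for `C^{(j)}_Λ` from its entry decay** (unit sites → unit sites, one site per fibre): `(E, δ)`.
[cite: Balaban1984PropagatorsII, p.246 («a covariance C^{(j)}_Λ … has an exponential decay»)] -/
theorem blockBound_C_of_entry {E δ : ℝ} (hE : 0 ≤ E)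
    (hCe : ∀ x x' : Site (⟨d + 1, L, m, K, hd, hL⟩ : Params) j, |(tsV1 hc Λ' w).C (EuclideanSpace.single x' (1 : ℝ)) x| ≤
      E * Real.exp (-(δ * torusSupNorm (Mk (⟨d + 1, L, m, K, hd, hL⟩ : Params) j) (rep (Mk (⟨d + 1, L, m, K, hd, hL⟩ : Params) j) x - rep (Mk (⟨d + 1, L, m, K, hd, hL⟩ : Params) j) x'))))
    (x y : Site (⟨d + 1, L, m, K, hd, hL⟩ : Params) j) :
    ∑ x' ∈ univ.filter (fun x' : Site (⟨d + 1, L, m, K, hd, hL⟩ : Params) j => x' = y), |(tsV1 hc Λ' w).C (EuclideanSpace.single x' (1 : ℝ)) x| ≤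
      E * ((1 : ℕ) : ℝ) * Real.exp (-(δ * torusSupNorm (Mk (⟨d + 1, L, m, K, hd, hL⟩ : Params) j) (rep (Mk (⟨d + 1, L, m, K, hd, hL⟩ : Params) j) x - rep (Mk (⟨d + 1, L, m, K, hd, hL⟩ : Params) j) y))) :=
  blockBound_of_entry (ρ := (fun t t' : Site (⟨d + 1, L, m, K, hd, hL⟩ : Params) j => torusSupNorm (Mk (⟨d + 1, L, m, K, hd, hL⟩ : Params) j) (rep (Mk (⟨d + 1, L, m, K, hd, hL⟩ : Params) j) t - rep (Mk (⟨d + 1, L, m, K, hd, hL⟩ : Params) j) t')))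
    (tsV1 hc Λ' w).C (fun y : Site (⟨d + 1, L, m, K, hd, hL⟩ : Params) j => y) (fun y : Site (⟨d + 1, L, m, K, hd, hL⟩ : Params) j => y) hE
    (card_filter_eq_le_one (P := (⟨d + 1, L, m, K, hd, hL⟩ : Params)) (j := j)) (fun x x' => hCe x x') x y

omit [NeZero L] [DecidableEq (PBond (⟨d + 1, L, m, K, hd, hL⟩ : Params) 0)] in
/-- **THE ENTRY DECAY OF `C^{(j)}_Λ`, UNIFORMLY** (gen 12's `cov_kernel_decay_sites` with the order of quantifiers literal and the `c`-dependence
isolated): `∃ δ > 0, E ≥ 0` (depending on `d, L` only) with `|C^{(j)}_Λ(e_{x′})_x| ≤ E/((c/n)⁴n^{d+1})·e^{−δ|x − x′|_T}` for all volumes, `c ≠ 0`,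
`j + 1 ≤ m + K`, `Λ′`, positive weights. [cite: Balaban1984PropagatorsII, p.246 («C^{(j)}_Λ … bounded from above by a positive constant dependent on d and L only, and it has an exponential decay»)] -/
theorem cov_entry_uniform (d L : ℕ) (hd : 1 ≤ d + 1) (hL : Odd L ∧ 1 < L) :
    ∃ δ : ℝ, 0 < δ ∧ ∃ E : ℝ, 0 ≤ E ∧ ∀ (m K : ℕ) (c : ℝ) (hc : c ≠ 0) (j : ℕ)
      (_hj : j + 1 ≤ (⟨d + 1, L, m, K, hd, hL⟩ : Params).m + (⟨d + 1, L, m, K, hd, hL⟩ : Params).K)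
      (Λ' : Finset (Site (⟨d + 1, L, m, K, hd, hL⟩ : Params) (j + 1))) (w : CIdx j Λ' → ℝ) (_hw : ∀ i, 0 < w i)
      (x x' : Site (⟨d + 1, L, m, K, hd, hL⟩ : Params) j),
      |(tsV1 hc Λ' w).C (EuclideanSpace.single x' (1 : ℝ)) x| ≤
        E / ((c / (L : ℝ) ^ j) ^ 4 * ((L : ℝ) ^ j) ^ (d + 1)) *
          Real.exp (-(δ * torusSupNorm (Mk (⟨d + 1, L, m, K, hd, hL⟩ : Params) j) (rep (Mk (⟨d + 1, L, m, K, hd, hL⟩ : Params) j) x - rep (Mk (⟨d + 1, L, m, K, hd, hL⟩ : Params) j) x'))) := by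
  have hL0 : 0 < L := by have := hL.2; omega
  have hLp : (0 : ℝ) < L := by exact_mod_cast hL0
  have h1L : (1 : ℝ) ≤ L := by exact_mod_cast hL0
  have hL1 : (0 : ℝ) ≤ (L : ℝ) - 1 := by linarith
  have hκ0 : 0 < kappaN (d + 1) / ((d : ℝ) + 1) := div_pos (kappaN_pos _) (by positivity)
  have hc0 := c0_2109_pos (d + 1)
  refine ⟨_, delta0_pos (d := d) hL, 2 * Real.exp (kappaN (d + 1) / ((d : ℝ) + 1) * ((L : ℝ) - 1)) / (c0_2109 (d + 1) * (8 / (L : ℝ) ^ 2) ^ 2),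
    by positivity, fun m K c hc j hj Λ' w hw x x' => ?_⟩
  have h := cov_kernel_decay_sites hc Λ' hw hj x x'
  rw [EuclideanSpace.inner_single_left, map_one, one_mul] at h
  refine h.trans (mul_le_mul_of_nonneg_right ?_ (Real.exp_pos _).le)
  have hθ : 0 < (c / (L : ℝ) ^ j) ^ 4 * ((L : ℝ) ^ j) ^ (d + 1) := by positivity
  -- `e^{2δ₀(L−1)} ≤ e^{κ(L−1)}` since `δ₀ ≤ κ/2`
  have hexp : Real.exp (2 * min (kappaN (d + 1) / ((d : ℝ) + 1) / 2) (c0_2109 (d + 1) * (8 / (L : ℝ) ^ 2) ^ 2 /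
      (2 * (B6Hprime2101.MdP (d + 1) * periodConst (kappaN (d + 1)) d *
        (Real.exp (kappaN (d + 1) / ((d : ℝ) + 1) * ((L : ℝ) - 1)) * (4 / (kappaN (d + 1) / ((d : ℝ) + 1)) + 2 * ((L : ℝ) - 1)) *
          latticeConst (d + 1) (kappaN (d + 1) / ((d : ℝ) + 1) / 4)) + 1))) * ((L : ℝ) - 1)) ≤
      Real.exp (kappaN (d + 1) / ((d : ℝ) + 1) * ((L : ℝ) - 1)) := by
    refine Real.exp_le_exp.2 ?_
    have := min_le_left (kappaN (d + 1) / ((d : ℝ) + 1) / 2) (c0_2109 (d + 1) * (8 / (L : ℝ) ^ 2) ^ 2 /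
      (2 * (B6Hprime2101.MdP (d + 1) * periodConst (kappaN (d + 1)) d *
        (Real.exp (kappaN (d + 1) / ((d : ℝ) + 1) * ((L : ℝ) - 1)) * (4 / (kappaN (d + 1) / ((d : ℝ) + 1)) + 2 * ((L : ℝ) - 1)) *
          latticeConst (d + 1) (kappaN (d + 1) / ((d : ℝ) + 1) / 4)) + 1)))
    nlinarith
  rw [div_mul_eq_mul_div, div_le_div_iff₀ (by positivity) hθ]
  calc 2 * Real.exp (2 * min (kappaN (d + 1) / ((d : ℝ) + 1) / 2) (c0_2109 (d + 1) * (8 / (L : ℝ) ^ 2) ^ 2 /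
          (2 * (B6Hprime2101.MdP (d + 1) * periodConst (kappaN (d + 1)) d *
            (Real.exp (kappaN (d + 1) / ((d : ℝ) + 1) * ((L : ℝ) - 1)) * (4 / (kappaN (d + 1) / ((d : ℝ) + 1)) + 2 * ((L : ℝ) - 1)) *
              latticeConst (d + 1) (kappaN (d + 1) / ((d : ℝ) + 1) / 4)) + 1))) * ((L : ℝ) - 1)) *
          ((c / (L : ℝ) ^ j) ^ 4 * ((L : ℝ) ^ j) ^ (d + 1))
      ≤ 2 * Real.exp (kappaN (d + 1) / ((d : ℝ) + 1) * ((L : ℝ) - 1)) * ((c / (L : ℝ) ^ j) ^ 4 * ((L : ℝ) ^ j) ^ (d + 1)) := by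
        gcongr
    _ = _ := by field_simp

end Factors

end Literature.MathematicalPhysics.QuantumFieldTheory.Balaban1983to89.B6BlockDecayHprimeCovV1

end
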